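import Mathlib

/-!
# Negative results on `PencilRigidity.NPointIsotropy`, I: signed permutations of `ℝ⁴` and the 7-plane

Support file 1/4 of the refutation of the MODEL-BLIND form of the crux `NPointIsotropy`
(stmt-QuantumFields-11686; main theorem in `ModelBlindFalse.lean`). Here: the 384 signed permutations
`sp σ ε` of `ℝ⁴` (`W(B₄)`), the characterisation of axis-permuting isometries as signed permutations, and
the linear parametrisation `A : ℝ⁷ → (ℝ⁴)⁴`, `A (x, s, t, r) = (x, x + s e₃, x + t e₂, x + r e₀)` of the
7-plane carrying the junk four-point functional, with the key combinatorial fact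
`sp_symm_planar_coord_zero`/`exists_pair_inner_eq`: every signed-permutation preimage of a vector of the
`(e₀,e₁)`-plane is orthogonal to one of the three offsets.
-/

noncomputable section

-- Mathlib's `SimplexCategory` instance `Fintype (Fin (x.len + 1))` matches `Fintype (Fin 4)` and makes concrete
-- `Fin 4` instance paths diverge between elaborations (tree-known workaround, cf.
-- `Literature/Geometry/Riemannian/PieceMetricLocalExtension.lean`).
attribute [-instance] SimplexCategory.instFintypeToTypeOrderHomFinHAddNatLenOfNat

namespace Summit.QuantumFields.YangMills.Theorems.NPointIsotropy.Negative

open scoped BigOperators InnerProductSpace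

/-- `ℝ⁴`. -/
abbrev E4 : Type := EuclideanSpace ℝ (Fin 4)

/-- Parameter space `ℝ⁷ = (x, s, t, r)` of the 7-plane. -/
abbrev D7 : Type := EuclideanSpace ℝ (Fin 7)

/-- A Boolean sign as a real number. -/
def sgn (b : Bool) : ℝ := if b then -1 else 1

/-- The sign of `true` is `-1`. -/
@[simp] theorem sgn_true : sgn true = -1 := rfl

/-- The sign of `false` is `1`. -/
@[simp] theorem sgn_false : sgn false = 1 := rfl

/-- `sgn` turns `xor` into multiplication. -/
theorem sgn_xor (a b : Bool) : sgn (xor a b) = sgn a * sgn b := by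
  cases a <;> cases b <;> simp [sgn]

/-- Signs square to `1`. -/
theorem sgn_mul_self (a : Bool) : sgn a * sgn a = 1 := by cases a <;> simp [sgn]

/-- Signs are non-zero. -/
theorem sgn_ne_zero (a : Bool) : sgn a ≠ 0 := by cases a <;> simp [sgn]

/-- Signs have absolute value `1`. -/
theorem abs_sgn (a : Bool) : |sgn a| = 1 := by cases a <;> simp [sgn]

/-- Coordinate sign flips. -/
def signFlip (ε : Fin 4 → Bool) : E4 ≃ₗᵢ[ℝ] E4 :=
  LinearIsometryEquiv.piLpCongrRight 2 fun i =>
    if ε i then (LinearIsometryEquiv.neg ℝ : ℝ ≃ₗᵢ[ℝ] ℝ) else LinearIsometryEquiv.refl ℝ ℝ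

/-- Coordinates of a sign flip. -/
@[simp] theorem signFlip_apply (ε : Fin 4 → Bool) (x : E4) (j : Fin 4) :
    signFlip ε x j = sgn (ε j) * x j := by
  unfold signFlip
  rw [LinearIsometryEquiv.piLpCongrRight_apply]
  by_cases h : ε j <;> simp [h, sgn]

/-- Coordinate permutations. -/
def permIso (σ : Equiv.Perm (Fin 4)) : E4 ≃ₗᵢ[ℝ] E4 :=
  LinearIsometryEquiv.piLpCongrLeft 2 ℝ ℝ σ

/-- Coordinates of a coordinate permutation. -/
@[simp] theorem permIso_apply (σ : Equiv.Perm (Fin 4)) (x : E4) (j : Fin 4) :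
    permIso σ x j = x (σ.symm j) := by
  unfold permIso
  simp [LinearIsometryEquiv.piLpCongrLeft_apply, Equiv.piCongrLeft'_apply]

/-- The signed permutation `eᵢ ↦ sgn (ε i) • e_{σ i}` (all 384 elements of `W(B₄)` as `(σ, ε)` vary). -/
def sp (σ : Equiv.Perm (Fin 4)) (ε : Fin 4 → Bool) : E4 ≃ₗᵢ[ℝ] E4 :=
  (signFlip ε).trans (permIso σ)

/-- Coordinates of a signed permutation: `(sp σ ε x)ⱼ = sgn (ε (σ⁻¹ j)) · x (σ⁻¹ j)`. -/
@[simp] theorem sp_apply (σ : Equiv.Perm (Fin 4)) (ε : Fin 4 → Bool) (x : E4) (j : Fin 4) :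
    sp σ ε x j = sgn (ε (σ.symm j)) * x (σ.symm j) := by
  simp [sp]

/-- Coordinates of the inverse signed permutation. -/
@[simp] theorem sp_symm_apply (σ : Equiv.Perm (Fin 4)) (ε : Fin 4 → Bool) (x : E4) (i : Fin 4) :
    (sp σ ε).symm x i = sgn (ε i) * x (σ i) := by
  have h : sp σ ε ((sp σ ε).symm x) = x := (sp σ ε).apply_symm_apply x
  have h' := congrArg (fun v : E4 => v (σ i)) h
  simp only [sp_apply, Equiv.symm_apply_apply] at h'
  -- h' : sgn (ε i) * (sp σ ε).symm x i = x (σ i)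
  have := congrArg (fun t => sgn (ε i) * t) h'
  simp only [← mul_assoc, sgn_mul_self, one_mul] at this
  exact this

/-- Composition law of signed permutations (the index set is a group). -/
theorem sp_comp_apply (τ σ : Equiv.Perm (Fin 4)) (δ ε : Fin 4 → Bool) (x : E4) :
    sp τ δ (sp σ ε x) = sp (τ * σ) (fun i => xor (δ (σ i)) (ε i)) x := by
  ext j
  simp only [sp_apply, Equiv.Perm.mul_def, Equiv.symm_trans_apply, sgn_xor,
    Equiv.apply_symm_apply]
  ring

/-- The identity signed permutation. -/
theorem sp_one_false (x : E4) : sp 1 (fun _ => false) x = x := by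
  ext j; simp only [sp_apply, sgn_false, one_mul]; rfl

/-- A signed permutation maps the axis vector `c eᵢ` to `sgn (ε i) c e_{σ i}`. -/
theorem sp_single (σ : Equiv.Perm (Fin 4)) (ε : Fin 4 → Bool) (i : Fin 4) (c : ℝ) :
    sp σ ε (EuclideanSpace.single i c) = EuclideanSpace.single (σ i) (sgn (ε i) * c) := by
  ext j
  simp only [sp_apply, PiLp.single_apply]
  by_cases h : j = σ i
  · subst h; simp
  · have h' : σ.symm j ≠ i := fun h'' => h (by rw [← h'', Equiv.apply_symm_apply])
    simp [h, h']

/-- `L` permutes the coordinate axes up to sign. -/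
def IsHyper (L : E4 ≃ₗᵢ[ℝ] E4) : Prop :=
  ∀ i : Fin 4, ∃ j : Fin 4, L (EuclideanSpace.single i 1) = EuclideanSpace.single j 1 ∨
    L (EuclideanSpace.single i 1) = -EuclideanSpace.single j 1

/-- The inverse of an axis-permuting isometry permutes the axes. -/
theorem IsHyper.symm {L : E4 ≃ₗᵢ[ℝ] E4} (h : IsHyper L) : IsHyper L.symm := by
  classical
  choose j hj using h
  have hj' : ∀ i, ∃ b : Bool, L (EuclideanSpace.single i 1) = sgn b • EuclideanSpace.single (j i) 1 := by
    intro i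
    rcases hj i with h | h
    · exact ⟨false, by simp [h]⟩
    · exact ⟨true, by simp [h]⟩
  choose b hb using hj'
  have hinj : Function.Injective j := by
    intro i i' hii'
    by_contra hne
    have h0 : ⟪EuclideanSpace.single i (1 : ℝ), EuclideanSpace.single i' 1⟫_ℝ = 0 := by
      rw [EuclideanSpace.inner_single_left]; simp [hne]
    rw [← L.inner_map_map, hb i, hb i', real_inner_smul_left, real_inner_smul_right, hii',
      EuclideanSpace.inner_single_left] at h0
    simp [sgn_ne_zero] at h0
  have hsurj : Function.Surjective j := Finite.surjective_of_injective hinj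
  intro k
  obtain ⟨i, rfl⟩ := hsurj k
  refine ⟨i, ?_⟩
  have : L.symm (EuclideanSpace.single (j i) 1) = sgn (b i) • EuclideanSpace.single i 1 := by
    apply L.injective
    rw [LinearIsometryEquiv.apply_symm_apply, map_smul, hb i, smul_smul, sgn_mul_self, one_smul]
  rcases Bool.eq_false_or_eq_true (b i) with hbi | hbi
  · right
    rw [this, hbi]
    simp
  · left
    rw [this, hbi]
    simp

/-- An isometry permuting the axes up to sign IS one of the 384 signed permutations `sp τ δ`. -/
theorem exists_sp_of_isHyper {L : E4 ≃ₗᵢ[ℝ] E4} (h : IsHyper L) :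
    ∃ (τ : Equiv.Perm (Fin 4)) (δ : Fin 4 → Bool), ∀ x, L x = sp τ δ x := by
  classical
  choose j hj using h
  have hj' : ∀ i, ∃ b : Bool, L (EuclideanSpace.single i 1) = sgn b • EuclideanSpace.single (j i) 1 := by
    intro i
    rcases hj i with h | h
    · exact ⟨false, by simp [h]⟩
    · exact ⟨true, by simp [h]⟩
  choose b hb using hj'
  have hinj : Function.Injective j := by
    intro i i' hii'
    by_contra hne
    have h0 : ⟪EuclideanSpace.single i (1 : ℝ), EuclideanSpace.single i' 1⟫_ℝ = 0 := by
      rw [EuclideanSpace.inner_single_left]; simp [hne]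
    rw [← L.inner_map_map, hb i, hb i', real_inner_smul_left, real_inner_smul_right, hii',
      EuclideanSpace.inner_single_left] at h0
    simp [sgn_ne_zero] at h0
  let τ : Equiv.Perm (Fin 4) := Equiv.ofBijective j (Finite.injective_iff_bijective.1 hinj)
  refine ⟨τ, b, fun x => ?_⟩
  have hlin : (L.toLinearEquiv : E4 →ₗ[ℝ] E4) = ((sp τ b).toLinearEquiv : E4 →ₗ[ℝ] E4) := by
    refine (EuclideanSpace.basisFun (Fin 4) ℝ).toBasis.ext fun i => ?_
    simp only [OrthonormalBasis.coe_toBasis, EuclideanSpace.basisFun_apply,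
      LinearEquiv.coe_coe, LinearIsometryEquiv.coe_toLinearEquiv]
    rw [hb i, sp_single, mul_one]
    show sgn (b i) • EuclideanSpace.single (j i) (1 : ℝ) = EuclideanSpace.single (j i) (sgn (b i))
    ext k
    by_cases hk : k = j i <;> simp [hk]
  exact LinearMap.congr_fun hlin x

/-- Index type of the signed permutations `W(B₄)` (`|W(B₄)| = 24 · 16 = 384`). -/
abbrev WIdx : Type := Equiv.Perm (Fin 4) × (Fin 4 → Bool)

/-- The re-indexing of `W(B₄)` by left multiplication with `(τ, δ)`. -/
def shear (τ : Equiv.Perm (Fin 4)) (δ : Fin 4 → Bool) : WIdx ≃ WIdx where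
  toFun g := (τ * g.1, fun i => xor (δ (g.1 i)) (g.2 i))
  invFun g := (τ⁻¹ * g.1, fun i => xor (δ ((τ⁻¹ * g.1) i)) (g.2 i))
  left_inv g := by
    rcases g with ⟨σ, ε⟩
    simp only [inv_mul_cancel_left, Prod.mk.injEq, true_and]
    funext i
    cases δ (σ i) <;> cases ε i <;> rfl
  right_inv g := by
    rcases g with ⟨σ, ε⟩
    simp only [mul_inv_cancel_left, Prod.mk.injEq, true_and]
    funext i
    cases δ ((τ⁻¹ * σ) i) <;> cases ε i <;> rfl

/-! ### The 7-plane `A y = (x, x + s e₃, x + t e₂, x + r e₀)` -/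

/-- The `x`-part of `y = (x, s, t, r) ∈ ℝ⁷`. -/
def xOf (y : D7) : E4 := (EuclideanSpace.equiv (Fin 4) ℝ).symm fun j => y (Fin.castLE (by norm_num) j)

/-- Coordinates of the `x`-part. -/
@[simp] theorem xOf_apply (y : D7) (j : Fin 4) : xOf y j = y (Fin.castLE (by norm_num) j) := by
  simp [xOf]

/-- The offsets `(0, s e₃, t e₂, r e₀)`. -/
def offset (y : D7) : Fin 4 → E4 :=
  ![0, y 4 • EuclideanSpace.single 3 1, y 5 • EuclideanSpace.single 2 1, y 6 • EuclideanSpace.single 0 1]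

/-- The parametrisation of the 7-plane as a bare function. -/
def Afun (y : D7) : Fin 4 → E4 := fun i => xOf y + offset y i

/-- Additivity of the parametrisation. -/
theorem Afun_add (y y' : D7) : Afun (y + y') = Afun y + Afun y' := by
  funext i
  simp only [Afun, Pi.add_apply]
  have hx : xOf (y + y') = xOf y + xOf y' := by ext j; simp
  have ho : offset (y + y') i = offset y i + offset y' i := by
    fin_cases i <;> simp [offset, add_smul]
  rw [hx, ho]; abel

/-- Homogeneity of the parametrisation. -/
theorem Afun_smul (c : ℝ) (y : D7) : Afun (c • y) = c • Afun y := by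
  funext i
  simp only [Afun, Pi.smul_apply]
  have hx : xOf (c • y) = c • xOf y := by ext j; simp
  have ho : offset (c • y) i = c • offset y i := by
    fin_cases i <;> simp [offset, smul_smul]
  rw [hx, ho, smul_add]

/-- The parametrisation as a continuous linear map `ℝ⁷ →L (ℝ⁴)⁴`. -/
def A : D7 →L[ℝ] (Fin 4 → E4) :=
  LinearMap.toContinuousLinearMap
    { toFun := Afun, map_add' := Afun_add, map_smul' := Afun_smul }

/-- Unfolding the parametrisation. -/
@[simp] theorem A_apply (y : D7) (i : Fin 4) : A y i = xOf y + offset y i := rfl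

/-- The base point of the pattern is `x`. -/
theorem A_zero (y : D7) : A y 0 = xOf y := by simp [offset]

/-- First offset: `A y 1 - A y 0 = s e₃`. -/
theorem A_one_sub (y : D7) : A y 1 - A y 0 = y 4 • EuclideanSpace.single 3 1 := by
  simp [offset]

/-- Second offset: `A y 2 - A y 0 = t e₂`. -/
theorem A_two_sub (y : D7) : A y 2 - A y 0 = y 5 • EuclideanSpace.single 2 1 := by
  simp [offset]

/-- Third offset: `A y 3 - A y 0 = r e₀`. -/
theorem A_three_sub (y : D7) : A y 3 - A y 0 = y 6 • EuclideanSpace.single 0 1 := by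
  simp [offset]

/-- **(L1)** If `w` vanishes in coordinate `3`, `2` or `0`, two points of the 7-plane have the same
pairing with `w`. -/
theorem exists_pair_inner_eq (y : D7) (w : E4) (hw : w 3 = 0 ∨ w 2 = 0 ∨ w 0 = 0) :
    ∃ p q : Fin 4, p ≠ q ∧ ⟪A y p, w⟫_ℝ = ⟪A y q, w⟫_ℝ := by
  rcases hw with h | h | h
  · refine ⟨1, 0, by decide, ?_⟩
    have := A_one_sub y
    rw [sub_eq_iff_eq_add] at this
    rw [this, inner_add_left, real_inner_smul_left, EuclideanSpace.inner_single_left]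
    simp [h]
  · refine ⟨2, 0, by decide, ?_⟩
    have := A_two_sub y
    rw [sub_eq_iff_eq_add] at this
    rw [this, inner_add_left, real_inner_smul_left, EuclideanSpace.inner_single_left]
    simp [h]
  · refine ⟨3, 0, by decide, ?_⟩
    have := A_three_sub y
    rw [sub_eq_iff_eq_add] at this
    rw [this, inner_add_left, real_inner_smul_left, EuclideanSpace.inner_single_left]
    simp [h]

/-- **(L1')** Every signed-permutation image of a vector of the `(e₀,e₁)`-plane vanishes in
coordinate `3`, `2` or `0`. -/
theorem sp_symm_planar_coord_zero (σ : Equiv.Perm (Fin 4)) (ε : Fin 4 → Bool) (a b : ℝ) :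
    let w := (sp σ ε).symm (a • EuclideanSpace.single 0 1 + b • EuclideanSpace.single 1 1)
    w 3 = 0 ∨ w 2 = 0 ∨ w 0 = 0 := by
  intro w
  have hw : ∀ i : Fin 4, σ i ≠ 0 → σ i ≠ 1 → w i = 0 := by
    intro i h0 h1
    simp [w, h0, h1]
  -- among the three coordinates 3, 2, 0 one is mapped by σ outside {0, 1}
  by_cases h3 : σ 3 ≠ 0 ∧ σ 3 ≠ 1
  · exact Or.inl (hw 3 h3.1 h3.2)
  by_cases h2 : σ 2 ≠ 0 ∧ σ 2 ≠ 1
  · exact Or.inr (Or.inl (hw 2 h2.1 h2.2))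
  refine Or.inr (Or.inr (hw 0 ?_ ?_))
  · intro h
    have hinj := σ.injective
    rcases not_and_or.1 h3 with h3 | h3 <;> rcases not_and_or.1 h2 with h2 | h2 <;>
      simp only [ne_eq, not_not] at h3 h2
    · exact absurd (hinj (h3.trans h2.symm)) (by decide)
    · exact absurd (hinj (h3.trans h.symm)) (by decide)
    · exact absurd (hinj (h2.trans h.symm)) (by decide)
    · exact absurd (hinj (h3.trans h2.symm)) (by decide)
  · intro h
    have hinj := σ.injective
    rcases not_and_or.1 h3 with h3 | h3 <;> rcases not_and_or.1 h2 with h2 | h2 <;>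
      simp only [ne_eq, not_not] at h3 h2
    · exact absurd (hinj (h3.trans h2.symm)) (by decide)
    · exact absurd (hinj (h2.trans h.symm)) (by decide)
    · exact absurd (hinj (h3.trans h.symm)) (by decide)
    · exact absurd (hinj (h3.trans h2.symm)) (by decide)

/-- Each coordinate of `y` is bounded by `2 ‖A y‖` (injectivity of `A`, quantitatively). -/
theorem abs_coord_le_two_norm_A (y : D7) (j : Fin 7) : |y j| ≤ 2 * ‖A y‖ := by
  have h0 : ‖xOf y‖ ≤ ‖A y‖ := by
    have := norm_le_pi_norm (A y) 0
    rwa [A_zero] at this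
  have hA0 : 0 ≤ ‖A y‖ := norm_nonneg _
  have hx : ∀ j' : Fin 4, |xOf y j'| ≤ 2 * ‖A y‖ := fun j' => by
    have h1 : |xOf y j'| ≤ ‖xOf y‖ := by
      simpa [Real.norm_eq_abs] using PiLp.norm_apply_le (xOf y) j'
    linarith
  have hdiff : ∀ (i : Fin 4) (k : Fin 4) (c : ℝ), A y i - A y 0 = c • EuclideanSpace.single k 1 →
      |c| ≤ 2 * ‖A y‖ := by
    intro i k c h
    have hn : ‖A y i - A y 0‖ = |c| := by
      rw [h, norm_smul, PiLp.norm_single, norm_one, mul_one, Real.norm_eq_abs]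
    have h2 : ‖A y i - A y 0‖ ≤ ‖A y i‖ + ‖A y 0‖ := norm_sub_le _ _
    have h3 : ‖A y i‖ ≤ ‖A y‖ := norm_le_pi_norm (A y) i
    have h4 : ‖A y 0‖ ≤ ‖A y‖ := norm_le_pi_norm (A y) 0
    linarith
  fin_cases j
  · simpa using hx 0
  · simpa using hx 1
  · simpa using hx 2
  · simpa using hx 3
  · exact hdiff 1 3 (y 4) (A_one_sub y)
  · exact hdiff 2 2 (y 5) (A_two_sub y)
  · exact hdiff 3 0 (y 6) (A_three_sub y)

/-- The lower bound `‖y‖ ≤ 7 (1 + ‖A y‖)` required by `SchwartzMap.compCLM`. -/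
theorem norm_le_A (y : D7) : ‖y‖ ≤ 7 * (1 + ‖A y‖) ^ 1 := by
  have hA0 : 0 ≤ ‖A y‖ := norm_nonneg _
  have hsq : ‖y‖ ^ 2 = ∑ j, |y j| ^ 2 := by
    rw [EuclideanSpace.norm_eq, Real.sq_sqrt (Finset.sum_nonneg fun j _ => by positivity)]
    simp [Real.norm_eq_abs]
  have hle : ∑ j : Fin 7, |y j| ^ 2 ≤ ∑ _j : Fin 7, (2 * ‖A y‖) ^ 2 :=
    Finset.sum_le_sum fun j _ => pow_le_pow_left₀ (abs_nonneg _) (abs_coord_le_two_norm_A y j) 2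
  have h7 : ∑ _j : Fin 7, (2 * ‖A y‖) ^ 2 = 28 * ‖A y‖ ^ 2 := by
    simp [Finset.sum_const, Finset.card_univ, Fintype.card_fin]; ring
  have hy : ‖y‖ ^ 2 ≤ (7 * (1 + ‖A y‖) ^ 1) ^ 2 := by
    rw [hsq]
    refine (hle.trans ?_)
    rw [h7]
    nlinarith
  exact (pow_le_pow_iff_left₀ (norm_nonneg _) (by positivity) two_ne_zero).1 hy

/-- The growth hypothesis of `SchwartzMap.compCLM` for `A`. -/
theorem A_upper : ∃ (k : ℕ) (C : ℝ), ∀ y : D7, ‖y‖ ≤ C * (1 + ‖A y‖) ^ k :=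
  ⟨1, 7, fun y => norm_le_A y⟩

/-- Embedding `x ↦ (x, 0, 0, 0)`. -/
def embed (v : E4) : D7 :=
  (EuclideanSpace.equiv (Fin 7) ℝ).symm fun j => if h : (j : ℕ) < 4 then v ⟨j, h⟩ else 0

/-- The embedded vector is the constant pattern: `A (embed v) i = v`. -/
theorem A_embed (v : E4) (i : Fin 4) : A (embed v) i = v := by
  have hx : xOf (embed v) = v := by
    ext j
    fin_cases j <;> simp [embed]
  have ho : offset (embed v) i = 0 := by
    fin_cases i <;> simp [offset, embed]
  rw [A_apply, hx, ho, add_zero]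

end Summit.QuantumFields.YangMills.Theorems.NPointIsotropy.Negative

end
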